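import Mathlib.Analysis.SpecialFunctions.ExpDeriv
import Literature.Analysis.ODE.OneSidedComparison
import Literature.Analysis.ODE.MaximalTime
import HarnessLib

/-!
# Shifted implicit-Euler majorant for a coupled linear system with bounded forcing: substep,
# squaring chain, a-priori closure (layer T of the ramp enclosure, exponential-free form;
# `pub-fluidc-bp3/R1-DESIGN.md` §6 G9)

HONEST FRAMING (cell `pub-fluidc`, blueprint seat bp3, gen 17): low prior, high value-of-information
experiment on Tao's machine paradigm; NOT a claim that NS blows up. This file is pure real analysis:
an elementary one-step comparison ("majorant") lemma for vector functions `z : ℝ → ι → ℝ` solving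
`zᵢ' = Σⱼ Kᵢⱼ(s) zⱼ + fᵢ(s)` on `[t₀, t₀ + h]`, with NO matrix exponential, NO Picard–Lindelöf and
NO Grönwall: only the mean-value inequality and a first-exit ("continuity") argument. It is the
abstract lemma `L1` of the kernel design of the ramp enclosure (R1-DESIGN §6 G5/G9): the kernel checks,
by `decide` on dyadic rationals, a non-negative matrix `B` dominating `|K(s) + cI|` on the piece, a
forcing bound `φ`, and a matrix `E ≥ 0` with `(I − hB)E ≥ I` entrywise (a rounded-up truncated
Neumann series of `(I − hB)⁻¹`); the lemma then transports the componentwise bound `|z(t₀)| ≤ u` to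
`|z(t₀ + h)| ≤ η · E (u + h η' φ)` for any `η ≥ e^{−ch}`, `η' ≥ e^{ch}` (`step`; the shifted form
`shifted_le` and the interior form `step_interior` serve the a-priori piece bound), and `2^S` such
substeps compose by REPEATED SQUARING of the augmented affine map with entrywise certificates
`A n · A n ≤ A (n+1)`, `A n · b n + b n ≤ b (n+1)` (`macroRow`; monotonicity `affine_mono`). What the
kernel of gen 18 must supply per macro row is therefore: dyadic tables `B, φ, E, A n, b n` with the
`decide`-checked inequalities, and the analytic inputs `hK`, `hf` (the frame-rate domination lemma).
The a-priori piece bound `W̄` at which the quadratic forcing is evaluated is closed by continuity in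
`rowClosure` (forcing bound assumed only while `|z| ≤ W̄`; certified no-decay interior bound
`rowInterior` strictly below `W̄` ⇒ everything unconditional).

PROOF (ten lines on paper). Put `z̃(s) = e^{c(s−t₀)} z(s)`; then `z̃ᵢ' = Σⱼ (Kᵢⱼ + cδᵢⱼ) z̃ⱼ +
e^{c(s−t₀)} fᵢ`, so `|z̃ᵢ'| ≤ (B|z̃|)ᵢ + η'φᵢ`. For `ε > 0` let `w = u + hη'φ + ε` and `v = Ew`, which
satisfies `w + hBv ≤ v`. Let `T*` be the maximal time of the closed condition `|z̃| ≤ v` on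
`[t₀, t₀+h]`; on `[t₀, T*]` the derivative bound `|z̃ᵢ'| ≤ (Bv)ᵢ + η'φᵢ` and the mean-value inequality
give `|z̃ᵢ(T*)| ≤ uᵢ + h((Bv)ᵢ + η'φᵢ) ≤ vᵢ − ε < vᵢ`, so the condition holds strictly at `T*`, hence
near `T*`, and the exit principle forces `T* = t₀ + h`. Undo the shift and let `ε → 0`.

CONTENTS OF THIS FILE (all sorry-free; every hypothesis a table inequality or an analytic input
named above): `vec_of_entrywise` (entrywise `(I − hB)E ≥ I` ⇒ the vector inequality `step` consumes) ·
`affine_mono` (non-negative affine bounds are monotone) · `shifted_le` (the shifted bound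
`e^{c(s−t₀)}|zᵢ(s)| ≤ (E(u + hη'φ))ᵢ` on the whole substep) · `step` (= L1, endpoint form with the
decay factor `η ≥ e^{−ch}`) · `step_interior` (interior form, no decay) · `exp_neg_le_inv_one_add`,
`exp_le_inv_one_sub` (the kernel's `η = 1/(1+ch)`, `η' = 1/(1−ch)` are admissible). The row-level lemmas
`macroRow` (= L2), `rowInterior`, `rowClosure` (the a-priori bound `W̄` closed by continuity) and
`rebox` are in `ImplicitMajorantRow.lean`.

References: folklore (continuity method; M-matrices / implicit Euler for Metzler systems), cf.
T. Tao, *Nonlinear dispersive equations*, CBMS 106 (2006), §1.3; the cell's `MaximalTime.lean`.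
Design: `pub-fluidc-bp3/R1-DESIGN.md` §6 G2 (identity), G5 (kernel K1–K6), G9 (this recipe).

[cite: Tao2016AveragedNS, §5.5 Thm 5.3 (5.5)]
-/

noncomputable section

open Set Real Filter Topology

namespace Summit.NavierStokesRegularity.FluidComputer

namespace ImplicitMajorant

open Literature.Analysis.ODE

variable {ι : Type*} [Fintype ι] [DecidableEq ι]

/-- From the ENTRYWISE matrix inequality `(I − hB)E ≥ I` (what the kernel checks by `decide`) to the
vector inequality `w + hB(Ew) ≤ Ew` for every `w ≥ 0` (what `step` consumes). [folklore] -/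
theorem vec_of_entrywise {B E : ι → ι → ℝ} {h : ℝ}
    (hIE : ∀ i k, (if i = k then (1:ℝ) else 0) ≤ E i k - h * ∑ j, B i j * E j k)
    (w : ι → ℝ) (hw : ∀ k, 0 ≤ w k) (i : ι) :
    w i + h * ∑ j, B i j * (∑ k, E j k * w k) ≤ ∑ k, E i k * w k := by
  have h1 : ∑ k, (if i = k then (1:ℝ) else 0) * w k
      ≤ ∑ k, (E i k - h * ∑ j, B i j * E j k) * w k :=
    Finset.sum_le_sum fun k _ => mul_le_mul_of_nonneg_right (hIE i k) (hw k)
  have h2 : ∑ k, (if i = k then (1:ℝ) else 0) * w k = w i := by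
    simp [ite_mul, Finset.sum_ite_eq, Finset.mem_univ]
  have h3 : ∑ k, (E i k - h * ∑ j, B i j * E j k) * w k
      = ∑ k, E i k * w k - h * ∑ j, B i j * (∑ k, E j k * w k) := by
    have : ∀ k, (E i k - h * ∑ j, B i j * E j k) * w k
        = E i k * w k - ∑ j, h * (B i j * (E j k * w k)) := by
      intro k
      rw [sub_mul, Finset.mul_sum, Finset.sum_mul]
      congr 1
      exact Finset.sum_congr rfl fun j _ => by ring
    simp_rw [this]
    rw [Finset.sum_sub_distrib, Finset.sum_comm]
    congr 1
    rw [Finset.mul_sum]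
    exact Finset.sum_congr rfl fun j _ => by rw [Finset.mul_sum, Finset.mul_sum]
  rw [h2, h3] at h1
  linarith

omit [DecidableEq ι] in
/-- Monotonicity of a non-negative affine bound (composition of substeps = squaring of the augmented
matrix, each rounded up, is sound): if `x ≤ y` componentwise, `A ≥ 0`, `A ≤ A'`, `b ≤ b'`, `y ≥ 0`, then
`A x + b ≤ A' y + b'`. [folklore] -/
theorem affine_mono {A A' : ι → ι → ℝ} {b b' x y : ι → ℝ}
    (hA : ∀ i k, 0 ≤ A i k) (hAA : ∀ i k, A i k ≤ A' i k) (hbb : ∀ i, b i ≤ b' i)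
    (hxy : ∀ k, x k ≤ y k) (hy : ∀ k, 0 ≤ y k) (i : ι) :
    ∑ k, A i k * x k + b i ≤ ∑ k, A' i k * y k + b' i := by
  have : ∑ k, A i k * x k ≤ ∑ k, A' i k * y k :=
    Finset.sum_le_sum fun k _ =>
      (mul_le_mul_of_nonneg_left (hxy k) (hA i k)).trans
        (mul_le_mul_of_nonneg_right (hAA i k) (hy k))
  linarith [hbb i]

/-- **The shifted bound behind L1.** `z` solves the coupled linear system `zᵢ' = Σⱼ Kᵢⱼ zⱼ + fᵢ` on
`[t₀, t₀+h)` (right derivatives, `z` continuous on `[t₀, t₀+h]`), `|Kᵢⱼ(s) + cδᵢⱼ| ≤ Bᵢⱼ`,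
`|fᵢ(s)| ≤ φᵢ`, `E ≥ 0` with `w + hB(Ew) ≤ Ew` for all `w ≥ 0` (`vec_of_entrywise`), `e^{ch} ≤ η'`.
Then `|z(t₀)| ≤ u` componentwise implies `e^{c(s−t₀)} |zᵢ(s)| ≤ Σₖ Eᵢₖ (uₖ + h η' φₖ)` for every
`s ∈ [t₀, t₀+h]`. [folklore] -/
theorem shifted_le {z : ℝ → ι → ℝ} {K : ℝ → ι → ι → ℝ} {f : ℝ → ι → ℝ}
    {B E : ι → ι → ℝ} {φ u : ι → ℝ} {t₀ h c η' : ℝ}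
    (hh : 0 < h) (hc : 0 ≤ c)
    (hzc : ∀ i, ContinuousOn (fun s => z s i) (Icc t₀ (t₀ + h)))
    (hz : ∀ s ∈ Ico t₀ (t₀ + h), ∀ i,
      HasDerivWithinAt (fun r => z r i) (∑ j, K s i j * z s j + f s i) (Ici s) s)
    (hK : ∀ s ∈ Ico t₀ (t₀ + h), ∀ i j, |K s i j + (if i = j then c else 0)| ≤ B i j)
    (hf : ∀ s ∈ Ico t₀ (t₀ + h), ∀ i, |f s i| ≤ φ i)
    (hE0 : ∀ i k, 0 ≤ E i k)
    (hE : ∀ w : ι → ℝ, (∀ k, 0 ≤ w k) →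
      ∀ i, w i + h * ∑ j, B i j * (∑ k, E j k * w k) ≤ ∑ k, E i k * w k)
    (hη' : exp (c * h) ≤ η')
    (hu : ∀ i, |z t₀ i| ≤ u i) :
    ∀ s ∈ Icc t₀ (t₀ + h), ∀ i,
      exp (c * (s - t₀)) * |z s i| ≤ ∑ k, E i k * (u k + h * (η' * φ k)) := by
  classical
  have ht₀ : t₀ ∈ Ico t₀ (t₀ + h) := ⟨le_rfl, by linarith⟩
  have hab : t₀ ≤ t₀ + h := by linarith
  have hB0 : ∀ i j, 0 ≤ B i j := fun i j => (abs_nonneg _).trans (hK t₀ ht₀ i j)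
  have hφ0 : ∀ i, 0 ≤ φ i := fun i => (abs_nonneg _).trans (hf t₀ ht₀ i)
  have hu0 : ∀ i, 0 ≤ u i := fun i => (abs_nonneg _).trans (hu i)
  have hη'0 : 0 ≤ η' := (exp_pos _).le.trans hη'
  -- the shifted function
  set zt : ℝ → ι → ℝ := fun s i => exp (c * (s - t₀)) * z s i with hzt_def
  have hexp_c : ∀ s, ContinuousOn (fun r : ℝ => exp (c * (r - t₀))) (Icc t₀ s) := fun s =>
    (Real.continuous_exp.comp (continuous_const.mul (continuous_id.sub continuous_const))).continuousOn
  have hztc : ∀ i, ContinuousOn (fun s => zt s i) (Icc t₀ (t₀ + h)) := fun i =>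
    (hexp_c (t₀ + h)).mul (hzc i)
  have hexp_d : ∀ s, HasDerivAt (fun r : ℝ => exp (c * (r - t₀))) (exp (c * (s - t₀)) * c) s := by
    intro s
    have h1 : HasDerivAt (fun r : ℝ => c * (r - t₀)) (c * 1) s :=
      ((hasDerivAt_id s).sub_const t₀).const_mul c
    simpa using h1.exp
  have hztd : ∀ s ∈ Ico t₀ (t₀ + h), ∀ i, HasDerivWithinAt (fun r => zt r i)
      (exp (c * (s - t₀)) * c * z s i
        + exp (c * (s - t₀)) * (∑ j, K s i j * z s j + f s i)) (Ici s) s := by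
    intro s hs i
    exact (hexp_d s).hasDerivWithinAt.mul (hz s hs i)
  -- exponential factors
  have hexp_le : ∀ s ∈ Icc t₀ (t₀ + h), exp (c * (s - t₀)) ≤ η' := by
    intro s hs
    refine (exp_le_exp.2 ?_).trans hη'
    have : s - t₀ ≤ h := by linarith [hs.2]
    nlinarith
  have hexp_pos : ∀ s, 0 < exp (c * (s - t₀)) := fun s => exp_pos _
  -- main claim, for every ε > 0
  have main : ∀ ε > 0, ∀ s ∈ Icc t₀ (t₀ + h), ∀ i,
      |zt s i| ≤ ∑ k, E i k * (u k + h * (η' * φ k) + ε) := by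
    intro ε hε
    set w : ι → ℝ := fun k => u k + h * (η' * φ k) + ε with hw_def
    set v : ι → ℝ := fun i => ∑ k, E i k * w k with hv_def
    have hw0 : ∀ k, 0 ≤ w k := fun k => by
      have := hu0 k; have := hφ0 k; simp only [hw_def]; positivity
    have hvw : ∀ i, w i + h * ∑ j, B i j * v j ≤ v i := fun i => hE w hw0 i
    have hBv0 : ∀ i, 0 ≤ ∑ j, B i j * v j := fun i =>
      Finset.sum_nonneg fun j _ => mul_nonneg (hB0 i j)
        (Finset.sum_nonneg fun k _ => mul_nonneg (hE0 j k) (hw0 k))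
    have hwv : ∀ i, w i ≤ v i := fun i => by
      have h1 := hvw i
      have h2 : 0 ≤ h * ∑ j, B i j * v j := mul_nonneg hh.le (hBv0 i)
      linarith
    -- the closed condition
    let P : ℝ → Prop := fun t => ∀ i, |zt t i| ≤ v i
    have hPa : P t₀ := by
      intro i
      have : zt t₀ i = z t₀ i := by simp [hzt_def]
      rw [this]
      calc |z t₀ i| ≤ u i := hu i
        _ ≤ w i := by
            have : 0 ≤ h * (η' * φ i) := mul_nonneg hh.le (mul_nonneg hη'0 (hφ0 i))
            simp only [hw_def]; linarith
        _ ≤ v i := hwv i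
    have hclosed : ∀ t ∈ Ioc t₀ (t₀ + h), (∀ s ∈ Ico t₀ t, P s) → P t := by
      intro t ht hP i
      exact le_const_of_forall_Ico ((hztc i).abs) ht fun s hs => hP s hs i
    set T := maximalTimeP P t₀ (t₀ + h) with hT_def
    have hTmem : T ∈ Icc t₀ (t₀ + h) := maximalTimeP_mem hab hPa
    have hPT : ∀ t ∈ Icc t₀ T, P t := fun t ht => maximalTimeP_spec hab hPa hclosed ht
    -- derivative bound on [t₀, T)
    have hder : ∀ s ∈ Ico t₀ T, ∀ i,
        |exp (c * (s - t₀)) * c * z s i + exp (c * (s - t₀)) * (∑ j, K s i j * z s j + f s i)|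
          ≤ ∑ j, B i j * v j + η' * φ i := by
      intro s hs i
      have hs' : s ∈ Ico t₀ (t₀ + h) := ⟨hs.1, hs.2.trans_le hTmem.2⟩
      have hPs : P s := hPT s ⟨hs.1, hs.2.le⟩
      set e := exp (c * (s - t₀)) with he_def
      have he0 : 0 < e := hexp_pos s
      have heη : e ≤ η' := hexp_le s ⟨hs'.1, hs'.2.le⟩
      -- rewrite the derivative as Σ_j (K + cδ) (e z_j) + e f
      have hδ : ∑ j, (if i = j then c else 0) * (e * z s j) = c * (e * z s i) := by
        simp [ite_mul, Finset.sum_ite_eq, Finset.mem_univ]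
      have hsum : ∑ j, (K s i j + (if i = j then c else 0)) * (e * z s j)
          = e * ∑ j, K s i j * z s j + c * (e * z s i) := by
        rw [Finset.mul_sum, ← hδ, ← Finset.sum_add_distrib]
        exact Finset.sum_congr rfl fun j _ => by ring
      have hrw : e * c * z s i + e * (∑ j, K s i j * z s j + f s i)
          = ∑ j, (K s i j + (if i = j then c else 0)) * (e * z s j) + e * f s i := by
        rw [hsum]; ring
      rw [hrw]
      calc |∑ j, (K s i j + (if i = j then c else 0)) * (e * z s j) + e * f s i|
          ≤ ∑ j, |(K s i j + (if i = j then c else 0)) * (e * z s j)| + |e * f s i| :=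
            (abs_add_le _ _).trans (add_le_add (Finset.abs_sum_le_sum_abs _ _) le_rfl)
        _ ≤ ∑ j, B i j * v j + η' * φ i := by
            refine add_le_add (Finset.sum_le_sum fun j _ => ?_) ?_
            · rw [abs_mul]
              have h1 := hK s hs' i j
              have h2 : |e * z s j| ≤ v j := by simpa [hzt_def, he_def] using hPs j
              exact mul_le_mul h1 h2 (abs_nonneg _) (hB0 i j)
            · rw [abs_mul, abs_of_pos he0]
              exact mul_le_mul heη (hf s hs' i) (abs_nonneg _) hη'0
    -- mean value ⇒ strict bound at T
    have hstrict : ∀ i, |zt T i| ≤ v i - ε := by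
      intro i
      have hmv := abs_sub_le_mul_of_abs_deriv_right_le
        ((hztc i).mono (Icc_subset_Icc_right hTmem.2))
        (fun s hs => (hztd s ⟨hs.1, hs.2.trans_le hTmem.2⟩ i))
        (fun s hs => hder s hs i) T ⟨hTmem.1, le_rfl⟩
      have hM0 : 0 ≤ ∑ j, B i j * v j + η' * φ i := by
        have := hBv0 i; have := hφ0 i; positivity
      have hTt : T - t₀ ≤ h := by linarith [hTmem.2]
      have h0 : zt t₀ i = z t₀ i := by simp [hzt_def]
      have h0' : |zt t₀ i| ≤ u i := by rw [h0]; exact hu i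
      have h1 : |zt T i| ≤ |zt t₀ i| + (∑ j, B i j * v j + η' * φ i) * (T - t₀) := by
        linarith [abs_sub_abs_le_abs_sub (zt T i) (zt t₀ i)]
      have h2 : (∑ j, B i j * v j + η' * φ i) * (T - t₀)
          ≤ (∑ j, B i j * v j + η' * φ i) * h := mul_le_mul_of_nonneg_left hTt hM0
      have h3 : u i + (∑ j, B i j * v j + η' * φ i) * h = w i - ε + h * ∑ j, B i j * v j := by
        simp only [hw_def]; ring
      have := hvw i
      linarith
    -- exit principle ⇒ T = t₀ + h
    have hT : T = t₀ + h := by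
      rcases maximalTimeP_exit hab hPa with h1 | h1
      · exact h1
      · exfalso
        apply h1
        have : ∀ i, ∀ᶠ t in 𝓝[Icc t₀ (t₀ + h)] T, |zt t i| ≤ v i := by
          intro i
          have hlt : |zt T i| < v i := by linarith [hstrict i]
          have hcw : ContinuousWithinAt (fun s => |zt s i|) (Icc t₀ (t₀ + h)) T :=
            ((hztc i).abs) T hTmem
          exact (hcw.eventually_lt_const hlt).mono fun _ h => h.le
        exact Filter.eventually_all.2 this
    intro s hs i
    have := hPT s ⟨hs.1, hT.symm ▸ hs.2⟩ i
    simpa [hv_def, hw_def] using this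
  -- remove ε
  intro s hs i
  have hsh : exp (c * (s - t₀)) * |z s i| = |zt s i| := by
    simp only [hzt_def]
    rw [abs_mul, abs_of_pos (exp_pos _)]
  have hE1 : 0 ≤ ∑ k, E i k := Finset.sum_nonneg fun k _ => hE0 i k
  have key : ∀ ε > 0, exp (c * (s - t₀)) * |z s i|
      ≤ ∑ k, E i k * (u k + h * (η' * φ k)) + ε * ∑ k, E i k := by
    intro ε hε
    have hsplit : ∑ k, E i k * (u k + h * (η' * φ k) + ε)
        = ∑ k, E i k * (u k + h * (η' * φ k)) + ε * ∑ k, E i k := by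
      rw [Finset.mul_sum, ← Finset.sum_add_distrib]
      exact Finset.sum_congr rfl fun k _ => by ring
    rw [hsh, ← hsplit]
    exact main ε hε s hs i
  refine le_of_forall_pos_lt_add fun ε hε => ?_
  have hpos : 0 < ∑ k, E i k + 1 := by linarith
  have := key (ε / (∑ k, E i k + 1)) (div_pos hε hpos)
  have hlt : ε / (∑ k, E i k + 1) * ∑ k, E i k < ε := by
    calc ε / (∑ k, E i k + 1) * ∑ k, E i k
        < ε / (∑ k, E i k + 1) * (∑ k, E i k + 1) :=
          mul_lt_mul_of_pos_left (lt_add_one _) (div_pos hε hpos)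
      _ = ε := div_mul_cancel₀ ε hpos.ne'
  linarith

/-- **L1, the shifted implicit-Euler majorant step.** Under the hypotheses of `shifted_le` and
`e^{−ch} ≤ η`: `|z(t₀)| ≤ u` componentwise implies `|zᵢ(t₀+h)| ≤ η Σₖ Eᵢₖ (uₖ + h η' φₖ)`. [folklore] -/
theorem step {z : ℝ → ι → ℝ} {K : ℝ → ι → ι → ℝ} {f : ℝ → ι → ℝ}
    {B E : ι → ι → ℝ} {φ u : ι → ℝ} {t₀ h c η η' : ℝ}
    (hh : 0 < h) (hc : 0 ≤ c)
    (hzc : ∀ i, ContinuousOn (fun s => z s i) (Icc t₀ (t₀ + h)))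
    (hz : ∀ s ∈ Ico t₀ (t₀ + h), ∀ i,
      HasDerivWithinAt (fun r => z r i) (∑ j, K s i j * z s j + f s i) (Ici s) s)
    (hK : ∀ s ∈ Ico t₀ (t₀ + h), ∀ i j, |K s i j + (if i = j then c else 0)| ≤ B i j)
    (hf : ∀ s ∈ Ico t₀ (t₀ + h), ∀ i, |f s i| ≤ φ i)
    (hE0 : ∀ i k, 0 ≤ E i k)
    (hE : ∀ w : ι → ℝ, (∀ k, 0 ≤ w k) →
      ∀ i, w i + h * ∑ j, B i j * (∑ k, E j k * w k) ≤ ∑ k, E i k * w k)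
    (hη : exp (-(c * h)) ≤ η) (hη' : exp (c * h) ≤ η')
    (hu : ∀ i, |z t₀ i| ≤ u i) :
    ∀ i, |z (t₀ + h) i| ≤ η * ∑ k, E i k * (u k + h * (η' * φ k)) := by
  intro i
  have hab : t₀ ≤ t₀ + h := by linarith
  have h1 := shifted_le hh hc hzc hz hK hf hE0 hE hη' hu (t₀ + h) ⟨hab, le_rfl⟩ i
  have hη0 : 0 ≤ η := (exp_pos _).le.trans hη
  have hsh : |z (t₀ + h) i| = exp (-(c * h)) * (exp (c * (t₀ + h - t₀)) * |z (t₀ + h) i|) := by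
    have harg : -(c * h) + c * (t₀ + h - t₀) = 0 := by ring
    rw [← mul_assoc, ← Real.exp_add, harg, Real.exp_zero, one_mul]
  rw [hsh]
  have h0 : 0 ≤ exp (c * (t₀ + h - t₀)) * |z (t₀ + h) i| := by positivity
  calc exp (-(c * h)) * (exp (c * (t₀ + h - t₀)) * |z (t₀ + h) i|)
      ≤ η * (exp (c * (t₀ + h - t₀)) * |z (t₀ + h) i|) := mul_le_mul_of_nonneg_right hη h0
    _ ≤ η * ∑ k, E i k * (u k + h * (η' * φ k)) := mul_le_mul_of_nonneg_left h1 hη0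

/-- **Interior bound** (used for the a-priori piece bound `W̄` of the continuation argument, with the
no-decay chain): under the hypotheses of `shifted_le`, `|zᵢ(s)| ≤ Σₖ Eᵢₖ (uₖ + h η' φₖ)` for EVERY
`s ∈ [t₀, t₀+h]`. [folklore] -/
theorem step_interior {z : ℝ → ι → ℝ} {K : ℝ → ι → ι → ℝ} {f : ℝ → ι → ℝ}
    {B E : ι → ι → ℝ} {φ u : ι → ℝ} {t₀ h c η' : ℝ}
    (hh : 0 < h) (hc : 0 ≤ c)
    (hzc : ∀ i, ContinuousOn (fun s => z s i) (Icc t₀ (t₀ + h)))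
    (hz : ∀ s ∈ Ico t₀ (t₀ + h), ∀ i,
      HasDerivWithinAt (fun r => z r i) (∑ j, K s i j * z s j + f s i) (Ici s) s)
    (hK : ∀ s ∈ Ico t₀ (t₀ + h), ∀ i j, |K s i j + (if i = j then c else 0)| ≤ B i j)
    (hf : ∀ s ∈ Ico t₀ (t₀ + h), ∀ i, |f s i| ≤ φ i)
    (hE0 : ∀ i k, 0 ≤ E i k)
    (hE : ∀ w : ι → ℝ, (∀ k, 0 ≤ w k) →
      ∀ i, w i + h * ∑ j, B i j * (∑ k, E j k * w k) ≤ ∑ k, E i k * w k)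
    (hη' : exp (c * h) ≤ η')
    (hu : ∀ i, |z t₀ i| ≤ u i) :
    ∀ s ∈ Icc t₀ (t₀ + h), ∀ i, |z s i| ≤ ∑ k, E i k * (u k + h * (η' * φ k)) := by
  intro s hs i
  have h1 := shifted_le hh hc hzc hz hK hf hE0 hE hη' hu s hs i
  have he : 1 ≤ exp (c * (s - t₀)) := Real.one_le_exp (mul_nonneg hc (by linarith [hs.1]))
  have : |z s i| ≤ exp (c * (s - t₀)) * |z s i| := le_mul_of_one_le_left (abs_nonneg _) he
  exact this.trans h1

omit [Fintype ι] [DecidableEq ι] in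
/-- The kernel's decay factor: `e^{−ch} ≤ 1/(1 + ch)` for `c, h ≥ 0` (from `1 + x ≤ eˣ`), so
`η := 1/(1+ch)` (rounded up) is admissible in `step`. [folklore] -/
theorem exp_neg_le_inv_one_add {c h : ℝ} (hc : 0 ≤ c) (hh : 0 ≤ h) :
    exp (-(c * h)) ≤ 1 / (1 + c * h) := by
  have h1 : 0 < 1 + c * h := by positivity
  rw [le_div_iff₀ h1]
  have := Real.add_one_le_exp (c * h)
  have h2 : exp (-(c * h)) * exp (c * h) = 1 := by rw [← Real.exp_add]; simp
  nlinarith [exp_pos (-(c * h)), exp_pos (c * h)]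

omit [Fintype ι] [DecidableEq ι] in
/-- The kernel's growth factor: `e^{ch} ≤ 1/(1 − ch)` for `ch < 1`, so `η' := 1/(1−ch)` (rounded up)
is admissible in `step`. [folklore] -/
theorem exp_le_inv_one_sub {c h : ℝ} (hch : c * h < 1) : exp (c * h) ≤ 1 / (1 - c * h) := by
  have h1 : 0 < 1 - c * h := by linarith
  rw [le_div_iff₀ h1]
  have := Real.add_one_le_exp (-(c * h))
  have h2 : exp (c * h) * exp (-(c * h)) = 1 := by rw [← Real.exp_add]; simp
  nlinarith [exp_pos (-(c * h)), exp_pos (c * h)]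

end ImplicitMajorant

end Summit.NavierStokesRegularity.FluidComputer
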